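import Summits.SmoothPoincare4.SmoothPoincare4.Theorems.SymplecticOrigamiOrigamiFoldExistenceStubCleanOnePleatIroningRadial
import Summits.SmoothPoincare4.SmoothPoincare4.Theorems.SymplecticOrigamiOrigamiFoldExistenceStubCleanOnePleatIroningOrient
import Literature.Topology.FourManifolds.MilnorLinearIsotopy
import Literature.Topology.FourManifolds.SmoothOrientationDiffeomorphProofs

/-!
# Stub `stub_cleanOnePleatIroning` of line `shadow-pleats` for crux `OrigamiFoldExistence` — XIII:
# the standard-ball filling `Λ₀ = θ ∘ G ∘ ((r₀/R) ·)` of the crease of a clean single pleat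
(item stmt-SmoothPoincare4-7844, route SymplecticOrigami; seat c3, S5a worker, wave 2)

Thirteenth helper file for the registered stub `stub_cleanOnePleatIroning` (S5a): steps
(S1)–(S2) of the SMOOTH HALF of its remaining ingredient `CleanPleatIroningChart` (file III),
packaged as DATA for the abstract side determination (file X), inner collar (file XI) and
straightening (file XII).  For a single-pleat round-rim position `(ι, δ, e)` whose chart `e 0`
is clean (width `ε`), with chart shadow `G = proj5 ∘ ι ∘ e 0`, `R = 2 + ε/2`, `η₀ = ε/4`,
`r₀ = 1/2`: the radial family `r ↦ G(r ·)|S³` (`r₀ ≤ r ≤ R`) is a smooth isotopy of embedded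
`3`-spheres (file VI); it ends at the image of its start under a diffeomorphism `θ` of `ℝ⁴`
with `det dθ > 0` (file VII); hence (`exists_creaseFillingData`, registered sub-goal)
**`Λ₀ = θ ∘ G ∘ ((r₀/R) ·)` is a smooth injective immersion of `B_{2R}` with `Λ₀ = G` on the
crease sphere `S_R`**, `G` is an injective immersion of the shell `{R - η₀ < |u| < R + η₀}`,
and `det dΛ₀(R e₀) · det dG(R e₀)` has the sign of `det dG(r₀ e₀) · det dG(R e₀)` (chain rule:
`det dΛ₀(R e₀) = det dθ · det dG(r₀ e₀) · (r₀/R)⁴`) — positive by files VIII–IX, which is the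
orientation input of file X.  This file imports only files VI–VII.

Sources: M. W. Hirsch, *Differential Topology* (1976), Ch. 8 §1 (isotopy extension); files
VI–VII of this stub.
-/

noncomputable section

-- the prescribed namespace `Summit.<P>.<Sub>.…` duplicates `SmoothPoincare4` (P = Sub)
set_option linter.dupNamespace false

open scoped Manifold ContDiff Topology RealInnerProductSpace
open Set Function Filter Metric Module

namespace Summit.SmoothPoincare4.SmoothPoincare4.Theorems.OrigamiFoldExistence.ShadowPleats


/-! ### A small linear-algebra fact -/

section LinAlg

/-- The determinant of the homothety `c • id` of `ℝ⁴` is `c⁴`. -/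
theorem det_smul_id (c : ℝ) :
    (c • ContinuousLinearMap.id ℝ (EuclideanSpace ℝ (Fin 4))).det = c ^ 4 := by
  show LinearMap.det ((c • ContinuousLinearMap.id ℝ (EuclideanSpace ℝ (Fin 4)) :
      EuclideanSpace ℝ (Fin 4) →L[ℝ] EuclideanSpace ℝ (Fin 4)) :
        EuclideanSpace ℝ (Fin 4) →ₗ[ℝ] EuclideanSpace ℝ (Fin 4)) = c ^ 4
  rw [ContinuousLinearMap.toLinearMap_smul, ContinuousLinearMap.coe_id, LinearMap.det_smul,
    LinearMap.det_id, mul_one, finrank_euclideanSpace_fin]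

end LinAlg

/-! ### The filling of the crease of a clean single pleat -/

section Filling

variable {M : Type} [TopologicalSpace M] [ChartedSpace (EuclideanSpace ℝ (Fin 4)) M]
  {ι : M → EuclideanSpace ℝ (Fin 5)} {δ : ℝ} {e : Fin 1 → EuclideanSpace ℝ (Fin 4) → M}

/-- **The standard-ball filling of the crease (steps (S1)–(S2)) as data.**  For a single-pleat
round-rim position whose chart `e 0` is clean there are `ε > 0` (a cleanness width),
`R = 2 + ε/2`, `η₀ = ε/4` and a smooth `Λ₀ : ℝ⁴ → ℝ⁴` which is an injective immersion of the
open ball `B_{2R}`, agrees with the chart shadow `G` on the sphere `S_R`, such that `G` is an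
injective immersion of the shell `{R - η₀ < |u| < R + η₀}` and
`det dΛ₀(R e₀) · det dG(R e₀) > 0` as soon as `det dG(e₀/2) · det dG(R e₀) > 0`. [folklore] -/
theorem exists_creaseFillingData (h : IsPleatedPosition ι δ e) (hc : IsCleanPleat ι (e 0)) :
    ∃ (ε : ℝ) (Λ₀ : EuclideanSpace ℝ (Fin 4) → EuclideanSpace ℝ (Fin 4)), 0 < ε ∧ ContDiff ℝ ∞ Λ₀ ∧
      (∀ u ∈ ball (0 : EuclideanSpace ℝ (Fin 4)) (2 * (2 + ε / 2)), Injective (fderiv ℝ Λ₀ u)) ∧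
      InjOn Λ₀ (ball (0 : EuclideanSpace ℝ (Fin 4)) (2 * (2 + ε / 2))) ∧
      (∀ u : EuclideanSpace ℝ (Fin 4), ‖u‖ = 2 + ε / 2 → Λ₀ u = (proj5 ∘ ι ∘ e 0) u) ∧
      InjOn (proj5 ∘ ι ∘ e 0) {u : EuclideanSpace ℝ (Fin 4) |
        (2 + ε / 2) - ε / 4 < ‖u‖ ∧ ‖u‖ < (2 + ε / 2) + ε / 4} ∧
      (∀ u : EuclideanSpace ℝ (Fin 4), (2 + ε / 2) - ε / 4 < ‖u‖ → ‖u‖ < (2 + ε / 2) + ε / 4 →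
        Injective (fderiv ℝ (proj5 ∘ ι ∘ e 0) u)) ∧
      (0 < (fderiv ℝ (proj5 ∘ ι ∘ e 0) ((1 / 2 : ℝ) • EuclideanSpace.single (0 : Fin 4) (1 : ℝ))).det *
          (fderiv ℝ (proj5 ∘ ι ∘ e 0) ((2 + ε / 2) • EuclideanSpace.single (0 : Fin 4) (1 : ℝ))).det →
        0 < (fderiv ℝ Λ₀ ((2 + ε / 2) • EuclideanSpace.single (0 : Fin 4) (1 : ℝ))).det *
          (fderiv ℝ (proj5 ∘ ι ∘ e 0) ((2 + ε / 2) • EuclideanSpace.single (0 : Fin 4) (1 : ℝ))).det) := by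
  have hn : (∞ : WithTop ℕ∞) ≠ 0 := by simp
  -- the clean data
  obtain ⟨ε, hε, h3, hiso⟩ := smoothIsotopy_radial_of_isCleanPleat h hc
  obtain ⟨ε₁, -, h1, -, -, -, -⟩ := hc
  have hGs : ContDiff ℝ ∞ (proj5 ∘ ι ∘ e 0) := contDiff_chartShadow h
  have himm : ∀ u : EuclideanSpace ℝ (Fin 4), ‖u‖ ≠ 1 → ‖u‖ ≠ 2 →
      Injective (fderiv ℝ (proj5 ∘ ι ∘ e 0) u) := by
    intro u hu1 hu2
    refine injective_fderiv_chartShadow h ?_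
    rintro (hu | hu)
    · exact hu1 (mem_sphere_zero_iff_norm.1 hu)
    · exact hu2 (mem_sphere_zero_iff_norm.1 hu)
  -- radii
  set R : ℝ := 2 + ε / 2 with hR
  set r₀ : ℝ := 1 / 2 with hr₀
  have hRpos : 0 < R := by positivity
  have hR2 : 2 < R := by rw [hR]; linarith
  set c : ℝ := r₀ / R with hcdef
  have hcpos : 0 < c := by positivity
  have hcR : c * R = r₀ := by rw [hcdef]; field_simp
  -- (S1)+(S2): the radial isotopy and the orientation-preserving diffeomorphism `θ`
  obtain ⟨F⟩ := hiso r₀ R (by norm_num) (by rw [hR, hr₀]; linarith) (by rw [hR]; linarith)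
  obtain ⟨θ, hθ, hθdet⟩ := exists_diffeomorph_comp_eq_det_pos F
  have hθs : ContDiff ℝ ∞ (θ : EuclideanSpace ℝ (Fin 4) → EuclideanSpace ℝ (Fin 4)) :=
    contMDiff_iff_contDiff.1 θ.contMDiff
  -- the filling `Λ₀ = θ ∘ G ∘ (c ·)` of the crease by a standard ball
  obtain ⟨Λ₀, hΛ₀⟩ : ∃ Λ₀ : EuclideanSpace ℝ (Fin 4) → EuclideanSpace ℝ (Fin 4),
      Λ₀ = fun u => θ ((proj5 ∘ ι ∘ e 0) (c • u)) := ⟨_, rfl⟩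
  have hΛs : ContDiff ℝ ∞ Λ₀ := by
    rw [hΛ₀]; exact hθs.comp (hGs.comp (contDiff_const_smul c))
  have hnormc : ∀ u : EuclideanSpace ℝ (Fin 4), ‖c • u‖ = c * ‖u‖ := fun u => by
    rw [norm_smul, Real.norm_of_nonneg hcpos.le]
  have hcball : ∀ u : EuclideanSpace ℝ (Fin 4), ‖u‖ < 2 * R → ‖c • u‖ < 1 := by
    intro u hu
    rw [hnormc, hcdef, hr₀]
    rw [div_mul_eq_mul_div, div_lt_one hRpos]
    linarith
  -- the differential of `Λ₀`
  have hΛd : ∀ u : EuclideanSpace ℝ (Fin 4), HasFDerivAt Λ₀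
      ((fderiv ℝ (θ : EuclideanSpace ℝ (Fin 4) → EuclideanSpace ℝ (Fin 4))
          ((proj5 ∘ ι ∘ e 0) (c • u))).comp
        ((fderiv ℝ (proj5 ∘ ι ∘ e 0) (c • u)).comp
          (c • ContinuousLinearMap.id ℝ (EuclideanSpace ℝ (Fin 4))))) u := by
    intro u
    rw [hΛ₀]
    have h1' : HasFDerivAt (fun v : EuclideanSpace ℝ (Fin 4) => c • v)
        (c • ContinuousLinearMap.id ℝ (EuclideanSpace ℝ (Fin 4))) u :=
      (hasFDerivAt_id u).const_smul c
    have h2' : HasFDerivAt (proj5 ∘ ι ∘ e 0) (fderiv ℝ (proj5 ∘ ι ∘ e 0) (c • u)) (c • u) :=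
      (hGs.differentiable hn _).hasFDerivAt
    have h3' : HasFDerivAt (θ : EuclideanSpace ℝ (Fin 4) → EuclideanSpace ℝ (Fin 4))
        (fderiv ℝ (θ : EuclideanSpace ℝ (Fin 4) → EuclideanSpace ℝ (Fin 4))
          ((proj5 ∘ ι ∘ e 0) (c • u))) ((proj5 ∘ ι ∘ e 0) (c • u)) :=
      (hθs.differentiable hn _).hasFDerivAt
    exact h3'.comp u (h2'.comp u h1')
  have hcinj : Injective (c • ContinuousLinearMap.id ℝ (EuclideanSpace ℝ (Fin 4))) := by
    intro a b hab
    have hab' : c • a = c • b := hab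
    exact smul_right_injective (EuclideanSpace ℝ (Fin 4)) hcpos.ne' hab'
  have hΛimm : ∀ u ∈ ball (0 : EuclideanSpace ℝ (Fin 4)) (2 * R), Injective (fderiv ℝ Λ₀ u) := by
    intro u hu
    rw [(hΛd u).fderiv, ContinuousLinearMap.coe_comp, ContinuousLinearMap.coe_comp]
    have hcu : ‖c • u‖ < 1 := hcball u (mem_ball_zero_iff.1 hu)
    refine (Literature.Topology.FourManifolds.injective_of_det_ne_zero _ (hθdet _).ne').comp
      ((himm _ hcu.ne (by linarith)).comp hcinj)
  have hΛinj : InjOn Λ₀ (ball (0 : EuclideanSpace ℝ (Fin 4)) (2 * R)) := by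
    intro u hu v hv huv
    rw [hΛ₀] at huv
    have h' := θ.injective huv
    have hu1 : c • u ∈ closedBall (0 : EuclideanSpace ℝ (Fin 4)) 1 :=
      mem_closedBall_zero_iff.2 (hcball u (mem_ball_zero_iff.1 hu)).le
    have hv1 : c • v ∈ closedBall (0 : EuclideanSpace ℝ (Fin 4)) 1 :=
      mem_closedBall_zero_iff.2 (hcball v (mem_ball_zero_iff.1 hv)).le
    exact smul_right_injective _ hcpos.ne' (h1 hu1 hv1 h')
  -- `Λ₀ = G` on the crease sphere `S_R`
  have hagree : ∀ u : EuclideanSpace ℝ (Fin 4), ‖u‖ = R → Λ₀ u = (proj5 ∘ ι ∘ e 0) u := by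
    intro u hu
    have hx : R⁻¹ • u ∈ sphere (0 : EuclideanSpace ℝ (Fin 4)) 1 := by
      rw [mem_sphere_zero_iff_norm, norm_smul, Real.norm_of_nonneg (inv_nonneg.2 hRpos.le), hu,
        inv_mul_cancel₀ hRpos.ne']
    have key := congrFun hθ ⟨R⁻¹ • u, hx⟩
    simp only [Function.comp_apply, radialSphere] at key
    have hcu : c • u = r₀ • (R⁻¹ • u) := by
      rw [smul_smul, hcdef, div_eq_mul_inv]
    have hRu : R • (R⁻¹ • u) = u := by rw [smul_smul, mul_inv_cancel₀ hRpos.ne', one_smul]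
    rw [hΛ₀]
    show θ (proj5 (ι (e 0 (c • u)))) = proj5 (ι (e 0 u))
    rw [hcu, key, hRu]
  -- the collar shell `{R - η₀ < |u| < R + η₀}`, `η₀ = ε/4`, inside the clean collar
  set η₀ : ℝ := ε / 4 with hη₀
  have hη₀pos : 0 < η₀ := by positivity
  have hη₀R : η₀ < R := by rw [hη₀, hR]; linarith
  have hGinjC : InjOn (proj5 ∘ ι ∘ e 0)
      {u : EuclideanSpace ℝ (Fin 4) | R - η₀ < ‖u‖ ∧ ‖u‖ < R + η₀} := by
    refine h3.mono ?_
    rintro u ⟨hu1, hu2⟩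
    refine ⟨mem_closedBall_zero_iff.2 (by rw [hR, hη₀] at hu2; linarith), ?_⟩
    rw [mem_ball_zero_iff, not_lt]
    rw [hR, hη₀] at hu1; linarith
  have hGimmC : ∀ u : EuclideanSpace ℝ (Fin 4), R - η₀ < ‖u‖ → ‖u‖ < R + η₀ →
      Injective (fderiv ℝ (proj5 ∘ ι ∘ e 0) u) := by
    intro u hu1 hu2
    rw [hR, hη₀] at hu1 hu2
    exact himm u (by linarith) (by linarith)
  -- the orientation bookkeeping at `R e₀`: `det dΛ₀(R e₀) = det dθ · det dG(r₀ e₀) · c⁴`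
  set e0 : EuclideanSpace ℝ (Fin 4) := EuclideanSpace.single (0 : Fin 4) (1 : ℝ) with he0
  have hsign : 0 < (fderiv ℝ (proj5 ∘ ι ∘ e 0) (r₀ • e0)).det *
        (fderiv ℝ (proj5 ∘ ι ∘ e 0) (R • e0)).det →
      0 < (fderiv ℝ Λ₀ (R • e0)).det * (fderiv ℝ (proj5 ∘ ι ∘ e 0) (R • e0)).det := by
    intro hflip
    have hdet : (fderiv ℝ Λ₀ (R • e0)).det =
        (fderiv ℝ (θ : EuclideanSpace ℝ (Fin 4) → EuclideanSpace ℝ (Fin 4))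
          ((proj5 ∘ ι ∘ e 0) (c • (R • e0)))).det *
        ((fderiv ℝ (proj5 ∘ ι ∘ e 0) (c • (R • e0))).det * c ^ 4) := by
      rw [(hΛd (R • e0)).fderiv, ← det_smul_id c]
      exact Literature.Topology.FourManifolds.det_comp_comp _ _ _
    rw [hdet]
    have hce : c • (R • e0) = r₀ • e0 := by rw [smul_smul, hcR]
    rw [hce]
    have hθpos := hθdet ((proj5 ∘ ι ∘ e 0) (r₀ • e0))
    have hc4 : 0 < c ^ 4 := by positivity
    have : (fderiv ℝ (θ : EuclideanSpace ℝ (Fin 4) → EuclideanSpace ℝ (Fin 4))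
          ((proj5 ∘ ι ∘ e 0) (r₀ • e0))).det *
        ((fderiv ℝ (proj5 ∘ ι ∘ e 0) (r₀ • e0)).det * c ^ 4) *
          (fderiv ℝ (proj5 ∘ ι ∘ e 0) (R • e0)).det =
        ((fderiv ℝ (θ : EuclideanSpace ℝ (Fin 4) → EuclideanSpace ℝ (Fin 4))
          ((proj5 ∘ ι ∘ e 0) (r₀ • e0))).det * c ^ 4) *
          ((fderiv ℝ (proj5 ∘ ι ∘ e 0) (r₀ • e0)).det *
            (fderiv ℝ (proj5 ∘ ι ∘ e 0) (R • e0)).det) := by ring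
    rw [this]
    exact mul_pos (mul_pos hθpos hc4) hflip
  refine ⟨ε, Λ₀, hε, hΛs, ?_, ?_, ?_, ?_, ?_, ?_⟩
  · simpa only [hR] using hΛimm
  · simpa only [hR] using hΛinj
  · simpa only [hR] using hagree
  · simpa only [hR, hη₀] using hGinjC
  · simpa only [hR, hη₀] using hGimmC
  · simpa only [hR, hr₀, he0] using hsign

end Filling

end Summit.SmoothPoincare4.SmoothPoincare4.Theorems.OrigamiFoldExistence.ShadowPleats

end
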